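import Literature.MathematicalPhysics.QuantumFieldTheory.Balaban1983to89.T3CruxEstimates
import Literature.MathematicalPhysics.QuantumFieldTheory.Balaban1983to89.T3HeightwiseDensityBounds
import Literature.MathematicalPhysics.QuantumFieldTheory.Balaban1983to89.B10Eq41TorusHistories
import Literature.MathematicalPhysics.QuantumFieldTheory.Balaban1983to89.B10Eq71TorusLocal
import HarnessLib

/-!
# Route `UnitScaleTilt` — crux `FluctuationComparisonRegPrIntL` (stmt-QuantumFields-20520): THE HISTORY PARTITION OF THE FINE-FIELD SPACE — DEFINITIONS
# (discrete large-field histories `Q` of [Balaban1985UV3] (7) p.257 ∕ «Σ_{{Ω_j}}» of (41) p.266 as a typed measurable PARTITION; the small factor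
# `e^{−κp(g_i)²}` of (67)–(71) pp.273–274; the entropy COUNT itself is the companion file's theorem `historyCount`)

Definitions file of the history-partition support pair (this file: `LFLabel`, `IsLarge`, `histEvent`, `histOf`, `smallFactor`, `labelZero`
and their carrier lemmas; the companion proof file `FluctuationComparisonRegPrIntLHistoryPartition` proves the additivity over histories, the entropy count
`historyCount` and the cut-off-height rung).  TYPED by ideator `ym-r3-idea-1` g23 as the support file
`pub/ideators/ym-r3-idea-1/g23/FluctuationComparisonRegPrIntLHistoryPartition.lean` sha16 a0972f2ab344a419 (LINE g23-3 «history_resolved» minus its hypothesis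
rows, critic #461 P3 ∕ #465); SPLIT (definitions ∕ proofs, ≤ 400 l. each) and LANDED by width seat `ym3-torus-px20` g12, the ideator filing no Theorems by RULING
№36 — every declaration below is BYTE-IDENTICAL to the ideator's, only the file boundaries and this header are new.

CONTENT.  §0 the CARRIER: `LFLabel F K n := Σ j : Fin (K − n + 1), Plaq (F.P K) j` (the (level, plaquette) pairs of run `K` below the comparison height
`n`; finite), `IsLarge θ K n U (j,p)` (`θ(K − j) ≤ dist(Ū^{j}(∂p), 1)`), the HISTORY EVENTS `histEvent θ K n Q := {U | ∀ e, e ∈ Q ↔ IsLarge U e}` and the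
history map `histOf`; `mem_histEvent_iff`, `histEvent_disjoint`, `measurableSet_histEvent`, `iUnion_histEvent_eq_univ` (a measurable PARTITION indexed by the
finite type `Finset (LFLabel F K n)`), `histGood_eq_histEvent_empty` (`histGood = E_∅` for `n ≤ K`), `compl_histGood_subset_iUnion_ne`.  §2 the SMALL FACTOR
`smallFactor L γ b₀ p₀ κ i := e^{−κ·p(g_i)²}`, `g_i = √(γL^{−i})` (`B10.pFun`) — the ideator's closed `Prop` `HistoryCountCan` is NOT kept as a definition: its text is
the statement of the companion file's theorem `historyCount` (no schema, px8 g15's read 09:58Z).  §3 `labelZero` (the label `(0, p)` at the cut-off height) and `LFLabel.level_eq_zero`.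

HONEST: definitions and set∕measurability bookkeeping only; nothing of Bałaban's renormalisation-group analysis ((5)∕(6), (38)–(47), the 𝐑-operation) is
asserted or proved; the per-history bound LFT∘ for `K > n`, the stability letters, crux 20520 and `YM3TorusSU2` are NOT proved here; rung R3 = SU(2) YM₃ on T³ —
NOT d = 4, NOT infinite volume, NOT a mass gap, NOT Clay.

References: [Balaban1985UV3] T. Bałaban, Commun. Math. Phys. 102 (1985) 255–275: (2) p.256, (7) p.257, (11) p.258, (41) p.266, (67)–(71) pp.273–274;
[Balaban1987RG1] CMP 109 (1987) 249–301: (0.4), (0.11) p.253, (0.18) p.255.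
-/

noncomputable section

set_option autoImplicit false

open MeasureTheory Filter Topology Set
open scoped ENNReal NNReal
open Literature.MathematicalPhysics.QuantumFieldTheory.Balaban1983to89
open Literature.MathematicalPhysics.QuantumFieldTheory.Balaban1983to89.T3ContinuumYM3Torus
open Literature.MathematicalPhysics.QuantumFieldTheory.Balaban1983to89.T3LevelShift
open Literature.MathematicalPhysics.QuantumFieldTheory.Balaban1983to89.T3NestedUnitLaws
open Literature.MathematicalPhysics.QuantumFieldTheory.Balaban1983to89.T3UnitLawDensityEML
open Literature.MathematicalPhysics.QuantumFieldTheory.Balaban1983to89.T3UnitScaleTilt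
open Literature.MathematicalPhysics.QuantumFieldTheory.Balaban1983to89.T3RestrictedUnitDensity
open Literature.MathematicalPhysics.QuantumFieldTheory.Balaban1983to89.T3TiltDescent
open Literature.MathematicalPhysics.QuantumFieldTheory.Balaban1983to89.T3CruxEstimates
open Literature.MathematicalPhysics.QuantumFieldTheory.Balaban1983to89.T3HeightwiseDensityBounds
open Literature.MathematicalPhysics.QuantumFieldTheory.Balaban1983to89.Missing

namespace Summit.QuantumFields.YangMills.Theorems.FluctuationComparisonRegPrIntLHistoryPartition

/-! ## §0 The carrier: discrete large-field histories of run `K` below the comparison height `n`, and their events (a PARTITION) -/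

section Carrier

variable (F : T3Family)

/-- A LARGE-FIELD LABEL of run `K` below the comparison height `n`: a constrained level `j ≤ K − n` and a positively oriented plaquette of
`T^{(j)}` (print's pairs `(j, p′)`, cf. `B10Eq41TorusHistories.cand`).  Finite. [cite: Balaban1985UV3, (41) p.266] -/
abbrev LFLabel (K n : ℕ) : Type := Σ j : Fin (K - n + 1), Plaq (F.P K) j.val

/-- The plaquette `e = (j, p)` is `θ(K − j)`-LARGE for the fine field `U`: `dist(Ū^{j}(∂p), 1) ≥ θ(K − j)` — the large-field half of the
decomposition of unity (7) at level `j`. [cite: Balaban1985UV3, (7) p.257] -/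
def IsLarge (θ : ℕ → ℝ) (K n : ℕ) (U : GaugeField (F.P K) 0 (Matrix.specialUnitaryGroup (Fin 2) ℂ)) (e : LFLabel F K n) : Prop :=
  θ (K - e.1.val) ≤ GaugeGroup.dist1 (GaugeField.plaqHol
    (Averaging.iter (fun i => BlockAveraging.blockAvg (P := F.P K) (j := i) ℰp) e.1.val U) e.2)

/-- The HISTORY EVENT of the discrete history `Q`: the set of fine fields whose large (level, plaquette) pairs below height `n` are EXACTLY `Q`
(one term of the expansion of `Π_j (χ_j + ζ_j)` over all constrained levels, «Σ_{{Ω_j}}» of (41)). [cite: Balaban1985UV3, (7) p.257 and (41) p.266] -/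
def histEvent (θ : ℕ → ℝ) (K n : ℕ) (Q : Finset (LFLabel F K n)) :
    Set (GaugeField (F.P K) 0 (Matrix.specialUnitaryGroup (Fin 2) ℂ)) :=
  {U | ∀ e : LFLabel F K n, e ∈ Q ↔ IsLarge F θ K n U e}

open Classical in
/-- The HISTORY of a fine field: its set of large pairs below height `n`. [cite: Balaban1985UV3, (41) p.266] -/
noncomputable def histOf (θ : ℕ → ℝ) (K n : ℕ) (U : GaugeField (F.P K) 0 (Matrix.specialUnitaryGroup (Fin 2) ℂ)) :
    Finset (LFLabel F K n) :=
  Finset.univ.filter (fun e => IsLarge F θ K n U e)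

variable {F}

/-- `U ∈ E_Q ↔ histOf U = Q`: the history events are the fibres of the history map. [cite: Balaban1985UV3, (41) p.266] -/
theorem mem_histEvent_iff {θ : ℕ → ℝ} {K n : ℕ} {Q : Finset (LFLabel F K n)}
    {U : GaugeField (F.P K) 0 (Matrix.specialUnitaryGroup (Fin 2) ℂ)} :
    U ∈ histEvent F θ K n Q ↔ histOf F θ K n U = Q := by
  classical
  simp only [histEvent, mem_setOf_eq, histOf, Finset.ext_iff, Finset.mem_filter, Finset.mem_univ, true_and]
  exact ⟨fun h e => (h e).symm, fun h e => (h e).symm⟩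

/-- Distinct histories have DISJOINT events. [cite: Balaban1985UV3, (41) p.266] -/
theorem histEvent_disjoint {θ : ℕ → ℝ} {K n : ℕ} {Q Q' : Finset (LFLabel F K n)} (h : Q ≠ Q') :
    Disjoint (histEvent F θ K n Q) (histEvent F θ K n Q') :=
  Set.disjoint_left.mpr fun _ hU hU' => h ((mem_histEvent_iff.mp hU).symm.trans (mem_histEvent_iff.mp hU'))

/-- The `k`-fold printed averaging of run `K` is measurable. [cite: Balaban1987RG1, (0.4) p.253 and (0.11) p.253] -/
theorem measurable_iterAvg (F : T3Family) (K : ℕ) :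
    ∀ k : ℕ, Measurable (Averaging.iter (fun i => BlockAveraging.blockAvg (P := F.P K) (j := i) ℰp) k)
  | 0 => measurable_id
  | k + 1 => (measurable_blockAvg F K k).comp (measurable_iterAvg F K k)

/-- The large-pair condition is a measurable event. [cite: Balaban1987RG1, (0.18) p.255] -/
theorem measurableSet_isLarge (θ : ℕ → ℝ) (K n : ℕ) (e : LFLabel F K n) :
    MeasurableSet {U : GaugeField (F.P K) 0 (Matrix.specialUnitaryGroup (Fin 2) ℂ) | IsLarge F θ K n U e} :=
  measurableSet_le measurable_const
    ((RegularGaugeGroup.measurable_dist1.comp (Missing.measurable_plaqHol e.2)).comp (measurable_iterAvg F K e.1.val))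

/-- History events are measurable (finite intersections of large∕small plaquette events). [cite: Balaban1987RG1, (0.18) p.255] -/
theorem measurableSet_histEvent (θ : ℕ → ℝ) (K n : ℕ) (Q : Finset (LFLabel F K n)) :
    MeasurableSet (histEvent F θ K n Q) := by
  have hset : histEvent F θ K n Q = ⋂ e : LFLabel F K n, {U | e ∈ Q ↔ IsLarge F θ K n U e} := by
    ext U; simp [histEvent]
  rw [hset]
  refine MeasurableSet.iInter fun e => ?_
  by_cases he : e ∈ Q
  · simp only [he, true_iff]
    exact measurableSet_isLarge θ K n e
  · simp only [he, false_iff]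
    exact (measurableSet_isLarge θ K n e).compl

/-- The history events COVER the space (every field has a history). [cite: Balaban1985UV3, (7) p.257] -/
theorem iUnion_histEvent_eq_univ (θ : ℕ → ℝ) (K n : ℕ) :
    (⋃ Q ∈ (Finset.univ : Finset (Finset (LFLabel F K n))), histEvent F θ K n Q) = Set.univ := by
  ext U
  simp only [Finset.mem_univ, iUnion_true, mem_iUnion, mem_univ, iff_true]
  exact ⟨histOf F θ K n U, mem_histEvent_iff.mpr rfl⟩

/-- The EMPTY history's event is Bałaban's small-history event `histGood` (for `n ≤ K`; the tree's `histGood` constrains exactly the levels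
`j` with `j + n ≤ K`). [cite: Balaban1985UV3, (7) p.257] -/
theorem histGood_eq_histEvent_empty (θ : ℕ → ℝ) {K n : ℕ} (hK : n ≤ K) :
    histGood F ℰp θ K n = histEvent F θ K n ∅ := by
  ext U
  simp only [histGood, PlaqSmall, mem_setOf_eq, histEvent, Finset.notMem_empty, false_iff, IsLarge, not_le]
  constructor
  · intro h e
    exact h e.1.val (by have := e.1.isLt; omega) e.2
  · intro h j hj p
    exact h ⟨⟨j, by omega⟩, p⟩

/-- The complement of the small-history event is covered by the events of the NON-EMPTY histories. [cite: Balaban1985UV3, (7) p.257 and (41) p.266] -/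
theorem compl_histGood_subset_iUnion_ne (θ : ℕ → ℝ) {K n : ℕ} (hK : n ≤ K) :
    (histGood F ℰp θ K n)ᶜ ⊆ ⋃ Q ∈ {Q : Finset (LFLabel F K n) | Q ≠ ∅}, histEvent F θ K n Q := by
  intro U hU
  simp only [mem_setOf_eq, mem_iUnion, exists_prop]
  refine ⟨histOf F θ K n U, fun h0 => hU ?_, mem_histEvent_iff.mpr rfl⟩
  rw [histGood_eq_histEvent_empty θ hK]
  exact mem_histEvent_iff.mpr h0

end Carrier

/-! ## §2 The small factor per large plaquette and the entropy row -/

/-- THE SMALL FACTOR PER LARGE PLAQUETTE at height `i` (lattice spacing `L^{−i}`): `e^{−κ·p(g_i)²}` with `g_i = √(γL^{−i})` and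
`p(g) = b₀(1 + log g⁻¹)^{p₀}` (tree `B10.pFun`) — print's «small factors connected with large fields regions» (pp.273–274, (67)–(71):
`exp(−c·p(g_j)²)` per plaquette of `P_j`). [cite: Balaban1985UV3, (67)-(71) pp.273-274 and (7) p.257] -/
noncomputable def smallFactor (L : ℕ) (γ b₀ p₀ κ : ℝ) (i : ℕ) : ℝ :=
  Real.exp (-(κ * (B10.pFun b₀ p₀ (Real.sqrt (γ * ((L : ℝ)⁻¹) ^ i))) ^ 2))

/-- The small factor is positive. [cite: Balaban1985UV3, (67)-(71) pp.273-274] -/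
theorem smallFactor_pos (L : ℕ) (γ b₀ p₀ κ : ℝ) (i : ℕ) : 0 < smallFactor L γ b₀ p₀ κ i := Real.exp_pos _

/-! ## §3 Labels at the cut-off height -/

section CutOff

variable {F : T3Family}

/-- At `K = n` every large-field label lives at the finest level `j = 0`. [cite: Balaban1985UV3, (41) p.266] -/
theorem LFLabel.level_eq_zero {n : ℕ} (e : LFLabel F n n) : e.1.val = 0 := by
  have h := e.1.isLt
  omega

variable (F) in
/-- The label `(0, p)` of a finest-level plaquette at the cut-off height. [cite: Balaban1985UV3, (41) p.266] -/
def labelZero (n : ℕ) (p : Plaq (F.P n) 0) : LFLabel F n n := ⟨⟨0, by omega⟩, p⟩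

/-- `labelZero` is injective. [cite: Balaban1985UV3, (41) p.266] -/
theorem labelZero_injective (n : ℕ) : Function.Injective (labelZero F n) := by
  intro p q h
  simp only [labelZero, Sigma.mk.injEq, heq_eq_eq, true_and] at h
  exact h

/-- `labelZero` is surjective at the cut-off height (every label has level `0`). [cite: Balaban1985UV3, (41) p.266] -/
theorem labelZero_surjective (n : ℕ) : Function.Surjective (labelZero F n) := by
  rintro ⟨⟨j, hj⟩, p⟩
  have hj0 : j = 0 := by omega
  subst hj0
  exact ⟨p, rfl⟩

end CutOff

end Summit.QuantumFields.YangMills.Theorems.FluctuationComparisonRegPrIntLHistoryPartition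

end
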